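import Literature.AlgebraicGeometry.Hu2025.Proofs.S01S09Interface.GammaQuadHuMatroid
import HarnessLib

/-!
# Hu 2025 Thm 9.4 / [Hu22] p.130 l.42–44 — «`(𝔾ⁿ_m/𝔾_m)` acts freely on the matroid Schubert cell `Gr^{3,E}_d`» HOLDS for the
# complete quadrilateral: `TorusFreeOnCell quadHuMatroid` (row 110c's field-valued-points reading), via a general
# rank–nullity criterion (joint J1 / GAP-LEDGER-HU row HU-R01, reading (β) — kernel support, OURS)

**HONEST FRAMING (D-0012/D-0089).** [Hu2025] (arXiv:2507.21400v1) / [Hu2022] (arXiv:2203.03842v4) are unrefereed preprints under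
adjudication; nothing of them is asserted. Row 110c (`R110cUniversalityInterface`) types «`(𝔾ⁿ_m/𝔾_m)` acts freely on the matroid
Schubert cell» (Thm 9.4, [Hu25] chunk p0072 l.121; [Hu22] p.130 l.42–44) at field-valued points as `TorusFreeOnCell M`: for every
field `K`, every `F` in the stratum of `M` and every `t ∈ (Kˣ)ⁿ` with `t·F ⊆ F`, `t` is scalar. It is the field `hfree` of row 110
g/h's printed-setting records `Hu22Setup_printed(_ours)` (p523177 / p525500). THIS FILE proves it for the occurring family
`d = quadHuMatroid` of the complete quadrilateral (`GammaQuadHuMatroid`), the `d` of the J1 kernel inhabitants: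
* GENERAL CRITERION (`torusFreeOnCell_of_dI_add_lt`): if `d_S + d_{Sᶜ} < d` for every proper non-empty `S ⊂ [n]`, the torus acts
  freely on the stratum of `M`. Proof: for `t·F ⊆ F` the operator `diag(t) − t_{α₀}` on `F` has kernel inside `F ∩ E_S` and image
  inside `F ∩ E_{Sᶜ}`, `S = {α : t_α = t_{α₀}}` (`E_I` = row 110c's `coordSubspace`), so rank–nullity gives `d ≤ d_S + d_{Sᶜ}`
  (`le_dI_levelSet_add`) unless `S = [n]`.
* THE QUADRILATERAL (`dI_add_dI_compl_lt_quad`): `d_S + d_{Sᶜ} ≤ 2 < 3` for every proper non-empty `S ⊂ [9]`, from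
  `VertexMem quadHuMatroid u` (`d_I ≤ |u ∩ I|`, `GammaQuadHuMatroid.vertexMem_quadHuMatroid_iff`) at two suitable FRAME bases
  `u, u' ∈ {123, 124, 134, 234, 12β}` (all off `Γ_quad`).
* `torusFreeOnCell_quadHuMatroid : TorusFreeOnCell quadHuMatroid`.
OURS kernel statements about the typed carriers of rows 110c/110; nothing of the sources asserted. AI proof is weaker than expert review.
-/

noncomputable section

namespace Literature.AlgebraicGeometry.Hu2025.Statements.S01S09Interface

namespace TorusFree

open S03Pluecker Prop9_1Ours Module

variable {K : Type} [Field K] {n d : ℕ}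

/-! ## The level set of a torus element and the operator `diag(t) − t_{α₀}` on an invariant subspace -/

/-- The level set `S(t, α₀) = {α ∣ t_α = t_{α₀}}`. OURS.
[cite: Hu2025, Thm. 9.3/9.4 («the action of 𝔾ⁿ_m/𝔾_m on Gr^{d,n}_d is free») p.160–161; [Hu22] p.130 l.42–44; joint J1 = GAP-LEDGER-HU row HU-R01 (unrefereed preprints under adjudication, D-0012/D-0089 — kernel support on OUR typed carriers of row 110c; nothing of the sources asserted)] -/
def levelSet (t : Fin n → Kˣ) (α₀ : Fin n) : Finset (Fin n) := by
  classical exact Finset.univ.filter fun α => t α = t α₀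

/-- Membership in the level set.
[cite: Hu2025, Thm. 9.3/9.4 p.160–161; joint J1 = GAP-LEDGER-HU row HU-R01 (unrefereed preprints under adjudication, D-0012/D-0089 — kernel support on OUR typed carriers of row 110c; nothing of the sources asserted)] -/
theorem mem_levelSet {t : Fin n → Kˣ} {α₀ α : Fin n} : α ∈ levelSet t α₀ ↔ t α = t α₀ := by
  classical
  simp [levelSet]

/-- **The operator `diag(t) − t_{α₀}` on a torus-stable subspace `F`** (`t·F ⊆ F`). OURS.
[cite: Hu2025, Thm. 9.3/9.4 («the action of 𝔾ⁿ_m/𝔾_m on Gr^{d,n}_d is free») p.160–161; [Hu22] p.130 l.42–44; joint J1 = GAP-LEDGER-HU row HU-R01 (unrefereed preprints under adjudication, D-0012/D-0089 — kernel support on OUR typed carriers of row 110c; nothing of the sources asserted)] -/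
def shiftOp (F : Submodule K (Fin n → K)) (t : Fin n → Kˣ) (hF : ∀ v ∈ F, (fun α => (t α : K) * v α) ∈ F)
    (α₀ : Fin n) : F →ₗ[K] F where
  toFun v := ⟨fun α => ((t α : K) - t α₀) * (v : Fin n → K) α, by
    have h1 := hF v.1 v.2
    have h2 := F.smul_mem (t α₀ : K) v.2
    have e : (fun α => ((t α : K) - t α₀) * (v : Fin n → K) α) =
        (fun α => (t α : K) * (v : Fin n → K) α) - (t α₀ : K) • (v : Fin n → K) := by
      funext α; simp [sub_mul]
    rw [e]; exact F.sub_mem h1 h2⟩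
  map_add' v w := by
    ext α; simp [mul_add]
  map_smul' c v := by
    ext α; simp [mul_left_comm]

/-- The value of the operator.
[cite: Hu2025, Thm. 9.3/9.4 p.160–161; joint J1 = GAP-LEDGER-HU row HU-R01 (unrefereed preprints under adjudication, D-0012/D-0089 — kernel support on OUR typed carriers of row 110c; nothing of the sources asserted)] -/
theorem shiftOp_apply (F : Submodule K (Fin n → K)) (t : Fin n → Kˣ) (hF : ∀ v ∈ F, (fun α => (t α : K) * v α) ∈ F)
    (α₀ : Fin n) (v : F) (α : Fin n) :
    ((shiftOp F t hF α₀ v : F) : Fin n → K) α = ((t α : K) - t α₀) * (v : Fin n → K) α := rfl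

/-- **The kernel of `diag(t) − t_{α₀}` lies in `F ∩ E_S`**, `S` the level set.
[cite: Hu2025, Thm. 9.3/9.4 («the action of 𝔾ⁿ_m/𝔾_m on Gr^{d,n}_d is free») p.160–161; joint J1 = GAP-LEDGER-HU row HU-R01 (unrefereed preprints under adjudication, D-0012/D-0089 — kernel support on OUR typed carriers of row 110c; nothing of the sources asserted)] -/
theorem ker_shiftOp_le (F : Submodule K (Fin n → K)) (t : Fin n → Kˣ) (hF : ∀ v ∈ F, (fun α => (t α : K) * v α) ∈ F)
    (α₀ : Fin n) :
    (LinearMap.ker (shiftOp F t hF α₀)).map F.subtype ≤ F ⊓ coordSubspace K (levelSet t α₀) := by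
  rintro _ ⟨v, hv, rfl⟩
  refine ⟨v.2, ?_⟩
  show (v : Fin n → K) ∈ coordSubspace K (levelSet t α₀)
  rw [mem_coordSubspace]
  intro i hi
  rw [mem_levelSet] at hi
  have h0 := congrArg (fun w : F => (w : Fin n → K) i) (LinearMap.mem_ker.mp hv)
  simp only [shiftOp_apply, ZeroMemClass.coe_zero, Pi.zero_apply, mul_eq_zero] at h0
  rcases h0 with h0 | h0
  · exact absurd (Units.ext (sub_eq_zero.mp h0)) hi
  · exact h0

/-- **The image of `diag(t) − t_{α₀}` lies in `F ∩ E_{Sᶜ}`**, `S` the level set.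
[cite: Hu2025, Thm. 9.3/9.4 («the action of 𝔾ⁿ_m/𝔾_m on Gr^{d,n}_d is free») p.160–161; joint J1 = GAP-LEDGER-HU row HU-R01 (unrefereed preprints under adjudication, D-0012/D-0089 — kernel support on OUR typed carriers of row 110c; nothing of the sources asserted)] -/
theorem range_shiftOp_le (F : Submodule K (Fin n → K)) (t : Fin n → Kˣ) (hF : ∀ v ∈ F, (fun α => (t α : K) * v α) ∈ F)
    (α₀ : Fin n) :
    (LinearMap.range (shiftOp F t hF α₀)).map F.subtype ≤ F ⊓ coordSubspace K (levelSet t α₀)ᶜ := by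
  rintro _ ⟨w, ⟨v, rfl⟩, rfl⟩
  refine ⟨(shiftOp F t hF α₀ v).2, ?_⟩
  show ((shiftOp F t hF α₀ v : F) : Fin n → K) ∈ coordSubspace K (levelSet t α₀)ᶜ
  rw [mem_coordSubspace]
  intro i hi
  rw [Finset.mem_compl, not_not, mem_levelSet] at hi
  show ((t i : K) - t α₀) * (v : Fin n → K) i = 0
  rw [hi, sub_self, zero_mul]

/-- **Rank–nullity bound: `d ≤ d_S + d_{Sᶜ}`** for the level set `S` of any torus element `t` stabilising a point `F` of the stratum.
[cite: Hu2025, Thm. 9.3/9.4 («the action of 𝔾ⁿ_m/𝔾_m on Gr^{d,n}_d is free») p.160–161; [Hu22] p.130 l.42–44; joint J1 = GAP-LEDGER-HU row HU-R01 (unrefereed preprints under adjudication, D-0012/D-0089 — kernel support on OUR typed carriers of row 110c; nothing of the sources asserted)] -/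
theorem le_dI_levelSet_add (M : HuMatroid n d) {F : Submodule K (Fin n → K)} (hF : InStratum K M F) {t : Fin n → Kˣ}
    (ht : ∀ v ∈ F, (fun α => (t α : K) * v α) ∈ F) (α₀ : Fin n) :
    d ≤ M.dI (levelSet t α₀) + M.dI (levelSet t α₀)ᶜ := by
  have h1 : finrank K (LinearMap.ker (shiftOp F t ht α₀)) ≤ M.dI (levelSet t α₀) := by
    rw [← hF.2 (levelSet t α₀), ← Submodule.finrank_map_subtype_eq F (LinearMap.ker (shiftOp F t ht α₀))]
    exact Submodule.finrank_mono (ker_shiftOp_le F t ht α₀)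
  have h2 : finrank K (LinearMap.range (shiftOp F t ht α₀)) ≤ M.dI (levelSet t α₀)ᶜ := by
    rw [← hF.2 (levelSet t α₀)ᶜ, ← Submodule.finrank_map_subtype_eq F (LinearMap.range (shiftOp F t ht α₀))]
    exact Submodule.finrank_mono (range_shiftOp_le F t ht α₀)
  have h3 := LinearMap.finrank_range_add_finrank_ker (shiftOp F t ht α₀)
  rw [hF.1] at h3
  omega

/-- **FREENESS CRITERION**: if `d_S + d_{Sᶜ} < d` for every proper non-empty `S ⊂ [n]` (no separator), then `(𝔾ⁿ_m/𝔾_m)` acts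
freely on the stratum of `M` in row 110c's field-valued-points sense (`TorusFreeOnCell M`).
[cite: Hu2025, Thm. 9.3/9.4 («the action of 𝔾ⁿ_m/𝔾_m on Gr^{d,n}_d is free … acts freely on the matroid Schubert cell») p.160–161; [Hu22] p.130 l.42–44; joint J1 = GAP-LEDGER-HU row HU-R01 (unrefereed preprints under adjudication, D-0012/D-0089 — kernel support on OUR typed carriers of row 110c; nothing of the sources asserted)] -/
theorem torusFreeOnCell_of_dI_add_lt (M : HuMatroid n d)
    (h : ∀ S : Finset (Fin n), S.Nonempty → S ≠ Finset.univ → M.dI S + M.dI Sᶜ < d) : TorusFreeOnCell M := by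
  intro K _ F hF t ht α β
  by_contra hne
  have hS : levelSet t α ≠ Finset.univ := by
    intro hU
    have hβ : β ∈ levelSet t α := hU ▸ Finset.mem_univ β
    exact hne (mem_levelSet.mp hβ).symm
  have h1 := le_dI_levelSet_add M hF ht α
  have h2 := h (levelSet t α) ⟨α, mem_levelSet.mpr rfl⟩ hS
  omega

/-! ## The complete quadrilateral has no separator: `d_S + d_{Sᶜ} ≤ 2` for proper non-empty `S ⊂ [9]` -/

/-- `d_I ≤ |u ∩ I|` for every basis `u ∉ Γ_quad` of the quadrilateral family (`VertexMem`).
[cite: Hu2025, Prop. 9.1 / (9.1) («x_u ∈ Δ^{d,n}_d») p.159–160; joint J1 = GAP-LEDGER-HU row HU-R01 (unrefereed preprints under adjudication, D-0012/D-0089 — kernel support on OUR typed carriers of row 110c; nothing of the sources asserted)] -/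
theorem dI_le_card_inter {u : ℕ × ℕ × ℕ} (hu : u ∈ plIndexSet 9) (hΓ : u ∉ quadGamma) (I : Finset (Fin 9)) :
    quadHuMatroid.dI I ≤ (tripleSet 9 u ∩ I).card :=
  ((vertexMem_quadHuMatroid_iff hu).mpr hΓ).2 I

/-- Two bases bound `d_S + d_{Sᶜ}`.
[cite: Hu2025, Prop. 9.1 / (9.1) p.159–160, Thm. 9.3/9.4 p.160–161; joint J1 = GAP-LEDGER-HU row HU-R01 (unrefereed preprints under adjudication, D-0012/D-0089 — kernel support on OUR typed carriers of row 110c; nothing of the sources asserted)] -/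
theorem dI_add_le_of_bases {u u' : ℕ × ℕ × ℕ} (hu : u ∈ plIndexSet 9) (hΓ : u ∉ quadGamma) (hu' : u' ∈ plIndexSet 9)
    (hΓ' : u' ∉ quadGamma) (S : Finset (Fin 9)) :
    quadHuMatroid.dI S + quadHuMatroid.dI Sᶜ ≤ (tripleSet 9 u ∩ S).card + (tripleSet 9 u' ∩ Sᶜ).card :=
  Nat.add_le_add (dI_le_card_inter hu hΓ S) (dI_le_card_inter hu' hΓ' Sᶜ)

/-- Counting lemma: for `p ∈ S`, `q ∉ S`, `|{q, r, x} ∩ S| + |{p, r, x} ∩ Sᶜ| ≤ 2`.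
[cite: Hu2025, Thm. 9.3/9.4 p.160–161; joint J1 = GAP-LEDGER-HU row HU-R01 (unrefereed preprints under adjudication, D-0012/D-0089 — kernel support on OUR typed carriers of row 110c; nothing of the sources asserted)] -/
theorem card_key {ι : Type} [DecidableEq ι] [Fintype ι] (S : Finset ι) {p q : ι} (r x : ι) (hp : p ∈ S) (hq : q ∉ S) :
    (({q, r, x} : Finset ι) ∩ S).card + (({p, r, x} : Finset ι) ∩ Sᶜ).card ≤ 2 := by
  have h1 : ({q, r, x} : Finset ι) ∩ S ⊆ ({r, x} : Finset ι) ∩ S := by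
    intro i hi
    rw [Finset.mem_inter] at hi ⊢
    simp only [Finset.mem_insert, Finset.mem_singleton] at hi ⊢
    rcases hi with ⟨rfl | rfl | rfl, hiS⟩
    · exact absurd hiS hq
    · exact ⟨Or.inl rfl, hiS⟩
    · exact ⟨Or.inr rfl, hiS⟩
  have h2 : ({p, r, x} : Finset ι) ∩ Sᶜ ⊆ ({r, x} : Finset ι) \ S := by
    intro i hi
    rw [Finset.mem_inter, Finset.mem_compl] at hi
    rw [Finset.mem_sdiff]
    simp only [Finset.mem_insert, Finset.mem_singleton] at hi ⊢
    rcases hi with ⟨rfl | rfl | rfl, hiS⟩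
    · exact absurd hp hiS
    · exact ⟨Or.inl rfl, hiS⟩
    · exact ⟨Or.inr rfl, hiS⟩
  have h3 := Finset.card_le_card h1
  have h4 := Finset.card_le_card h2
  have h5 : (({r, x} : Finset ι) ∩ S).card + (({r, x} : Finset ι) \ S).card = ({r, x} : Finset ι).card :=
    Finset.card_inter_add_card_sdiff _ _
  have h6 : ({r, x} : Finset ι).card ≤ 2 := Finset.card_le_two
  omega

/-- Counting lemma: for `a, b ∈ S`, `x ∉ S`, `|{x, a, b} ∩ S| + |{a, b, c} ∩ Sᶜ| ≤ 2` when `c ∈ S`.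
[cite: Hu2025, Thm. 9.3/9.4 p.160–161; joint J1 = GAP-LEDGER-HU row HU-R01 (unrefereed preprints under adjudication, D-0012/D-0089 — kernel support on OUR typed carriers of row 110c; nothing of the sources asserted)] -/
theorem card_key' {ι : Type} [DecidableEq ι] [Fintype ι] (S : Finset ι) {x a b c : ι} (hx : x ∉ S) (ha : a ∈ S)
    (hb : b ∈ S) (hc : c ∈ S) :
    (({x, a, b} : Finset ι) ∩ S).card + (({a, b, c} : Finset ι) ∩ Sᶜ).card ≤ 2 := by
  have h1 : ({x, a, b} : Finset ι) ∩ S ⊆ ({a, b} : Finset ι) := by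
    intro i hi
    rw [Finset.mem_inter] at hi
    simp only [Finset.mem_insert, Finset.mem_singleton] at hi ⊢
    rcases hi with ⟨rfl | rfl | rfl, hiS⟩
    · exact absurd hiS hx
    · exact Or.inl rfl
    · exact Or.inr rfl
  have h2 : (({a, b, c} : Finset ι) ∩ Sᶜ).card = 0 := by
    rw [Finset.card_eq_zero, Finset.eq_empty_iff_forall_notMem]
    intro i hi
    rw [Finset.mem_inter, Finset.mem_compl] at hi
    simp only [Finset.mem_insert, Finset.mem_singleton] at hi
    rcases hi with ⟨rfl | rfl | rfl, hiS⟩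
    · exact hiS ha
    · exact hiS hb
    · exact hiS hc
  have h3 := Finset.card_le_card h1
  have h6 : ({a, b} : Finset ι).card ≤ 2 := Finset.card_le_two
  omega

/-- The frame triples as subsets of `[9] = Fin 9`.
[cite: Hu2025, §9 (9.1)/(9.2) (index triples as subsets) p.159–161; joint J1 = GAP-LEDGER-HU row HU-R01 (unrefereed preprints under adjudication, D-0012/D-0089 — kernel support on OUR typed carriers of row 110c; nothing of the sources asserted)] -/
theorem tripleSet_frames :
    tripleSet 9 (1, 2, 3) = ({0, 1, 2} : Finset (Fin 9)) ∧ tripleSet 9 (2, 3, 4) = ({1, 2, 3} : Finset (Fin 9)) ∧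
    tripleSet 9 (1, 3, 4) = ({0, 2, 3} : Finset (Fin 9)) ∧ tripleSet 9 (1, 2, 4) = ({0, 1, 3} : Finset (Fin 9)) := by
  refine ⟨by decide, by decide, by decide, by decide⟩

/-- `{1, 2, β+1}` as a subset: `{β, 0, 1}`.
[cite: Hu2025, §9 (9.1)/(9.2) (index triples as subsets) p.159–161; joint J1 = GAP-LEDGER-HU row HU-R01 (unrefereed preprints under adjudication, D-0012/D-0089 — kernel support on OUR typed carriers of row 110c; nothing of the sources asserted)] -/
theorem tripleSet_12β (β : Fin 9) : tripleSet 9 (1, 2, β.val + 1) = ({β, 0, 1} : Finset (Fin 9)) := by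
  ext i
  simp only [tripleSet, Finset.mem_filter, Finset.mem_univ, true_and, Finset.mem_insert, Finset.mem_singleton,
    Fin.ext_iff, Fin.val_zero, Fin.val_one]
  omega

/-- The frame triples are chart indices off `Γ_quad`.
[cite: Hu2025, Prop. 9.1 (Gr_d) p.160 / (9.2) (Γ_d); joint J1 = GAP-LEDGER-HU row HU-R01 (unrefereed preprints under adjudication, D-0012/D-0089 — kernel support on OUR typed carriers of row 110c; nothing of the sources asserted)] -/
theorem frames_ok :
    (((1, 2, 3) : ℕ × ℕ × ℕ) ∈ plIndexSet 9 ∧ ((1, 2, 3) : ℕ × ℕ × ℕ) ∉ quadGamma) ∧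
    (((2, 3, 4) : ℕ × ℕ × ℕ) ∈ plIndexSet 9 ∧ ((2, 3, 4) : ℕ × ℕ × ℕ) ∉ quadGamma) ∧
    (((1, 3, 4) : ℕ × ℕ × ℕ) ∈ plIndexSet 9 ∧ ((1, 3, 4) : ℕ × ℕ × ℕ) ∉ quadGamma) ∧
    (((1, 2, 4) : ℕ × ℕ × ℕ) ∈ plIndexSet 9 ∧ ((1, 2, 4) : ℕ × ℕ × ℕ) ∉ quadGamma) := by
  refine ⟨⟨by decide, by simp [quadGamma]⟩, ⟨by decide, by simp [quadGamma]⟩, ⟨by decide, by simp [quadGamma]⟩,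
    ⟨by decide, by simp [quadGamma]⟩⟩

/-- `(1, 2, β+1)` is a chart index off `Γ_quad` for `β ≥ 2` (as an element of `Fin 9`).
[cite: Hu2025, Prop. 9.1 (Gr_d) p.160 / (9.2) (Γ_d); joint J1 = GAP-LEDGER-HU row HU-R01 (unrefereed preprints under adjudication, D-0012/D-0089 — kernel support on OUR typed carriers of row 110c; nothing of the sources asserted)] -/
theorem frame_12β_ok (β : Fin 9) (hβ : 2 ≤ β.val) :
    ((1, 2, β.val + 1) : ℕ × ℕ × ℕ) ∈ plIndexSet 9 ∧ ((1, 2, β.val + 1) : ℕ × ℕ × ℕ) ∉ quadGamma := by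
  refine ⟨mem_plIndexSet (by norm_num) (by norm_num) (by omega) (by omega), ?_⟩
  simp [quadGamma]

/-- **The quadrilateral family has NO SEPARATOR: `d_S + d_{Sᶜ} ≤ 2 < 3`** for every proper non-empty `S ⊂ [9]`.
[cite: Hu2025, Thm. 9.3 («the action of 𝔾ⁿ_m/𝔾_m on Gr^{d,n}_d is free if and only if dim Δ^{d,n}_d = n − 1») / Thm. 9.4 p.160–161; [Hu22] p.130 l.42–44; joint J1 = GAP-LEDGER-HU row HU-R01 (unrefereed preprints under adjudication, D-0012/D-0089 — kernel support on OUR typed carriers of row 110c; nothing of the sources asserted)] -/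
theorem dI_add_dI_compl_lt_quad (S : Finset (Fin 9)) (hS : S.Nonempty) (hS' : S ≠ Finset.univ) :
    quadHuMatroid.dI S + quadHuMatroid.dI Sᶜ < 3 := by
  obtain ⟨⟨i123, g123⟩, ⟨i234, g234⟩, ⟨i134, g134⟩, ⟨i124, g124⟩⟩ := frames_ok
  obtain ⟨t123, t234, t134, t124⟩ := tripleSet_frames
  by_cases h0 : (0 : Fin 9) ∈ S <;> by_cases h1 : (1 : Fin 9) ∈ S <;> by_cases h2 : (2 : Fin 9) ∈ S
  · -- 0,1,2 ∈ S: some β ∉ S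
    obtain ⟨β, hβ⟩ : ∃ β : Fin 9, β ∉ S := by
      by_contra hc
      simp only [not_exists, not_not] at hc
      exact hS' (Finset.eq_univ_iff_forall.mpr hc)
    have hβ2 : 2 ≤ β.val := by
      by_contra hlt
      have h' : β.val = 0 ∨ β.val = 1 := by omega
      rcases h' with h' | h'
      · exact hβ (by rw [show β = 0 from Fin.ext h']; exact h0)
      · exact hβ (by rw [show β = 1 from Fin.ext h']; exact h1)
    obtain ⟨iβ, gβ⟩ := frame_12β_ok β hβ2
    have hb := dI_add_le_of_bases iβ gβ i123 g123 S
    rw [tripleSet_12β, t123] at hb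
    have hc := card_key' S hβ h0 h1 h2
    omega
  · have hb := dI_add_le_of_bases i234 g234 i124 g124 S
    rw [t234, t124] at hb
    have hc := card_key S (p := (0 : Fin 9)) (q := (2 : Fin 9)) (1 : Fin 9) (3 : Fin 9) h0 h2
    have e1 : ({2, 1, 3} : Finset (Fin 9)) = {1, 2, 3} := by decide
    rw [e1] at hc
    omega
  · have hb := dI_add_le_of_bases i234 g234 i134 g134 S
    rw [t234, t134] at hb
    have hc := card_key S (p := (0 : Fin 9)) (q := (1 : Fin 9)) (2 : Fin 9) (3 : Fin 9) h0 h1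
    omega
  · have hb := dI_add_le_of_bases i234 g234 i134 g134 S
    rw [t234, t134] at hb
    have hc := card_key S (p := (0 : Fin 9)) (q := (1 : Fin 9)) (2 : Fin 9) (3 : Fin 9) h0 h1
    omega
  · have hb := dI_add_le_of_bases i134 g134 i234 g234 S
    rw [t134, t234] at hb
    have hc := card_key S (p := (1 : Fin 9)) (q := (0 : Fin 9)) (2 : Fin 9) (3 : Fin 9) h1 h0
    omega
  · have hb := dI_add_le_of_bases i134 g134 i234 g234 S
    rw [t134, t234] at hb
    have hc := card_key S (p := (1 : Fin 9)) (q := (0 : Fin 9)) (2 : Fin 9) (3 : Fin 9) h1 h0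
    omega
  · have hb := dI_add_le_of_bases i124 g124 i234 g234 S
    rw [t124, t234] at hb
    have hc := card_key S (p := (2 : Fin 9)) (q := (0 : Fin 9)) (1 : Fin 9) (3 : Fin 9) h2 h0
    have e1 : ({2, 1, 3} : Finset (Fin 9)) = {1, 2, 3} := by decide
    rw [e1] at hc
    omega
  · -- 0,1,2 ∉ S: some β ∈ S
    obtain ⟨β, hβ⟩ := hS
    have hβ2 : 2 ≤ β.val := by
      by_contra hlt
      have h' : β.val = 0 ∨ β.val = 1 := by omega
      rcases h' with h' | h'
      · exact h0 (by rw [← show β = 0 from Fin.ext h']; exact hβ)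
      · exact h1 (by rw [← show β = 1 from Fin.ext h']; exact hβ)
    obtain ⟨iβ, gβ⟩ := frame_12β_ok β hβ2
    have hb := dI_add_le_of_bases i123 g123 iβ gβ S
    rw [tripleSet_12β, t123] at hb
    have h0' : (0 : Fin 9) ∈ Sᶜ := Finset.mem_compl.mpr h0
    have h1' : (1 : Fin 9) ∈ Sᶜ := Finset.mem_compl.mpr h1
    have h2' : (2 : Fin 9) ∈ Sᶜ := Finset.mem_compl.mpr h2
    have hβ' : β ∉ Sᶜ := fun h => Finset.mem_compl.mp h hβ
    have hc := card_key' Sᶜ hβ' h0' h1' h2'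
    rw [compl_compl] at hc
    omega

/-- **MAIN (W11d): `(𝔾⁹_m/𝔾_m)` ACTS FREELY on the matroid Schubert cell of the complete quadrilateral** — `TorusFreeOnCell
quadHuMatroid` (row 110c's field-valued-points reading of Thm 9.4's clause, the field `hfree` of `Hu22Setup_printed(_ours)`): for every
field `K`, every `F` in the stratum of `d_quad` and every `t ∈ (Kˣ)⁹` with `t·F ⊆ F`, `t` is scalar. OURS kernel statement about
the typed carrier; nothing of [Hu25]/[Hu22] asserted.
[cite: Hu2025, Thm. 9.4 («there exists a matroid d … such that (𝔾ⁿ_m/𝔾_m) acts freely on the matroid Schubert cell Gr^{3,E}_d») p.161, Thm. 9.3 p.160; [Hu22] p.130 l.42–44; joint J1 = GAP-LEDGER-HU row HU-R01, reading (β) (unrefereed preprints under adjudication, D-0012/D-0089 — kernel support on OUR typed carriers of rows 110c/110; nothing of the sources asserted)] -/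
theorem torusFreeOnCell_quadHuMatroid : TorusFreeOnCell quadHuMatroid :=
  torusFreeOnCell_of_dI_add_lt quadHuMatroid dI_add_dI_compl_lt_quad

end TorusFree

end Literature.AlgebraicGeometry.Hu2025.Statements.S01S09Interface

end
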